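/-
Copyright (c) 2026 the pub-hodgecm-mathlib formalisation cell (harness21).  Prover seat hodgecm-mathlib-R90-C10-p04 (g3), SLAB R90-TF, section S1 «Ch. 10∕12 local»,
cell «U4-RAM :182 (S-W) wild», brick (c1) (acting dealer = (S-W) line lead R90-C10-p05 (g3), R-SW-4 (c1), on the finding `R90/R90-C10-p05/g3/WILD-COVER-GAP.v1.md`
9381e9d31740a03d): FAMILY X ON THE TWO-DEPTH GROUP WITH A DEFECT-`δ` TRACE-ONE ELEMENT — the wild twin of ★ p862537 `K2E3TwoDepthDepthWitness.exists_familyX_witness_twoDepth`,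
crux H413 = `stmt-HodgeConjecture-24833`.  KERNEL module: THEOREMS ONLY (no definition, no named fact, no `sorry`, no instance, no notation).  2026-09-05.
-/
import Summits.HodgeConjecture.HodgeConjecture.Theorems.K2E3TwoDepthDepthWitness   -- ★ p862537 (K2E3-p37 (g2)): the tame family-X∕Z witnesses on `J_e`, the entry formulas; brings ★ X∕Z∕trace-one algebra, ★ D174 `test_twoDepth_iff`
import HarnessLib

/-!
# R90-TF S1 «Ch10-local» ∕ K2 E3 «U4Keys» :182, (S-W) WILD, det road — brick (c1): FAMILY X ON `J_e` WITH A TRACE-ONE ELEMENT OF DEFECT `δ`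
# «`ū(x,z)⁻¹ u(y, −yσy·t) ū(x,z) ∈ J_e` with `(0,0)` entry `(1+c)(1+ε)`, `|ε| ≤ |ϖ|^{m+1}`, when `|t|·|ϖ|^δ ≤ 1`, `δ ≤ m`, `|ϖ|ᵐ|z| ≤ |ϖ|^{δ+1}|x|²`, `s+δ ≤ 2r`, `s′+δ ≤ 2r′`»
# [Roche1998 §3–§4; BruhatTits1972 (6.4.9); Tits1979 §1.15; Rogawski1990 §1.10]

Cell `pub/hodgecm-mathlib` (D-0151), crux H413 = `stmt-HodgeConjecture-24833`, route of record `HCCMUnconditional` (no route verbs); R90-TF section S1, (S-W) wild programme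
(line lead R90-C10-p05 (g3)); THEOREMS ONLY; ★-only imports (NO `Lines` import); lane `--supports stmt-HodgeConjecture-24833 --as helper`, count-neutral.  NOT THE PAYER of any
socket: a MODEL brick (local-field frame `Valued K ℤᵐ⁰`, no CM data) of the (S-W-Rb) determinant road — the X half of the wild depth-witness cover (c3).

THE POINT (p05 (g3) `WILD-COVER-GAP.v1.md` §X).  In ★ `exists_familyX_witness_twoDepth` the trace-one element `t` (`t + σt = 1`) enters ONLY through `b = −yσy·t`, i.e. through the
single bound `|b| ≤ |y|²·|t|`; at a tame or unramified place an INTEGRAL `t` exists (`|t| ≤ 1`, letter `hvt`), at a WILD place the minimal one has `|t| = |ϖ|^{−δ}`, `δ = d − 1 ≥ 1`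
(★ (W-0) `R90S1WildTraceOneMinimal`, ★ bridge p865207).  Threading the factor `|t| ≤ |ϖ|^{−δ}` through ★'s dozen monomial bounds costs exactly: the `z`-regime shifts by `δ`
(`|ϖ|ᵐ|z| ≤ |ϖ|^{δ+1}|x|²`), the two concavity margins shift by `δ` (`s + δ ≤ 2r`, `s′ + δ ≤ 2r′`), and `δ ≤ m`; every other letter and the CONCLUSION are ★'s VERBATIM.
* **`exists_familyX_witness_twoDepth_ofDefect`** — ★ :123–:132 with `(hvt : |t| ≤ 1)` ↦ `{δ} (hδ : |t|·|ϖ|^δ ≤ 1) (hδm : δ ≤ m)`, `hz2`, `hs`, `hs′` shifted by `δ`; at `δ = 0` it is ★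
  (junction `example`).
HONEST LABEL.  HC_CM is proved only modulo the 7 printed citations (2 remaining named inputs: hLiu418 = `stmt-HodgeConjecture-24832`, h413 = `stmt-HodgeConjecture-24833`) until rung 0
closes; count-neutral — pays NO socket ((S-W) OPEN: REL over {HWA, HWRa, HWRb}); no printed citation is discharged; REL ≠ ★ ≠ BUILT.

## References
* [Roche1998] A. Roche, *Types and Hecke algebras for principal series representations of split reductive p-adic groups*, Ann. Sci. ÉNS (4) 31 (1998), §3–§4.
* [BruhatTits1972] F. Bruhat, J. Tits, *Groupes réductifs sur un corps local I*, Publ. Math. IHÉS 41 (1972), (6.4.9).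
* [Tits1979] J. Tits, *Reductive groups over local fields*, Proc. Sympos. Pure Math. 33.1 (1979), §1.15 (ramified unitary groups in three variables, residue characteristic 2).
* [Rogawski1990] J. D. Rogawski, *Automorphic Representations of Unitary Groups in Three Variables*, Ann. of Math. Stud. 123 (1990), §1.9–§1.10 pp. 8–9.
* [Serre1979] J.-P. Serre, *Local Fields*, GTM 67 (1979), Ch. II §1, Ch. III §3.
-/

set_option autoImplicit false
-- the mandated namespace repeats the single-problem summit's segment (`HodgeConjecture.HodgeConjecture`)
set_option linter.dupNamespace false

noncomputable section

open Matrix Literature.NumberTheory.Automorphic Literature.NumberTheory.Automorphic.UnitaryGroup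
open scoped Matrix MatrixGroups WithZero Pointwise

namespace Summit.HodgeConjecture.HodgeConjecture.R90.S1.WildFamilyXWitness

open Summit.HodgeConjecture.HodgeConjecture.Cruxes.H413
open Summit.HodgeConjecture.HodgeConjecture.Cruxes.H413.K2E3LevelNDepthWitnessZ
open Summit.HodgeConjecture.HodgeConjecture.Cruxes.H413.K2E3LevelNDepthWitnessX
open Summit.HodgeConjecture.HodgeConjecture.Cruxes.H413.K2E3LevelNDepthWitnessTraceOne
open Summit.HodgeConjecture.HodgeConjecture.Cruxes.H413.K2E3TwoDepthDepthWitness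

section Valuation

variable {K : Type*} [Field K] [Valued K ℤᵐ⁰] [ValuativeRel K] [(Valued.v : Valuation K ℤᵐ⁰).Compatible]
  (σ : K →+* K) {ϖ : K} {J : Matrix (Fin 3) (Fin 3) K} (hJ : J = (StdForm.antidiagonal 3).over K)
  (hσ : ∀ a, σ (σ a) = a) (hvσ : ∀ a, Valued.v (σ a) = Valued.v a) (hvϖ : Valued.v ϖ = WithZero.exp (-1 : ℤ))
  (r s r' s' : ℕ) (Jg : Subgroup ↥(unitaryGroupOfForm σ J))
  (hJg : ∀ k, k ∈ Jg ↔ ∀ i j, Valued.v (((k : GL (Fin 3) K) : Matrix (Fin 3) (Fin 3) K) i j) ≤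
    Valued.v ϖ ^ (![![0, r, s], ![r', 0, r], ![s', r', 0]] : Fin 3 → Fin 3 → ℕ) i j)

include hJ hσ hvσ hvϖ hJg in
set_option maxHeartbeats 1600000 in
-- one `u ∈ N`, seven entries, a dozen valuation bounds (as ★ X), the factor `|t| ≤ |ϖ|^{−δ}` threaded
/-- **FAMILY X ON `J_e` WITH A TRACE-ONE ELEMENT OF DEFECT `δ`.**  `ū ∈ U(σ, Φ₃)` with matrix `ū(x, z)` (`z + σz + xσx = 0`, `|x|, |z| ≤ 1`); ANY `c` with `|c| ≤ |ϖ|ᵐ`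
(`1 ≤ m`); a trace-one `t` (`t + σt = 1`) of DEFECT `δ ≤ m`: `|t|·|ϖ|^δ ≤ 1` (at a wild dyadic place the minimal `t` has `|t| = |ϖ|^{−(d−1)}`, ★ (W-0)); regime `|ϖ|ᵐ ≤ |ϖ|ʳ·|x|`,
`|ϖ|ᵐ·|z| ≤ |ϖ|^{r′}·|x|`, `|ϖ|ᵐ·|z| ≤ |ϖ|^{δ+1}·|x|²`; exponents `r′ ≤ m`, `s′ ≤ m`, `s + δ ≤ 2r`, `s′ + δ ≤ 2r′`.  Then `u := u(y, b)` with `y = −c∕σx`, `b = −yσy·t` lies in `N`,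
`ū⁻¹ u ū ∈ J_e` (★ D174's two-depth group, letters `(Jg, hJg)`), and `(ū⁻¹ u ū)₀₀ = (1 + c)(1 + ε)` with `|ε| ≤ |ϖ|^{m+1}` — the CONCLUSION of ★ `exists_familyX_witness_twoDepth` VERBATIM;
at `δ = 0` this IS ★ (junction `example` below).  Proof: ★'s, with `|b| = |y|²·|t|` and the two absorptions `|ϖ|^δ·|t| ≤ 1`, `|ϖ|ᵐ·|t| ≤ 1`.
[cite: Roche1998, §3–§4] [cite: Tits1979, §1.15] [cite: Rogawski1990, §1.10 p. 9] -/
theorem exists_familyX_witness_twoDepth_ofDefect {m : ℕ} (hm : 1 ≤ m) {nb : ↥(unitaryGroupOfForm σ J)} {x z c t : K}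
    (hnb : ((nb : GL (Fin 3) K) : Matrix (Fin 3) (Fin 3) K) = !![1, 0, 0; -σ x, 1, 0; z, x, 1]) (hrel : z + σ z + x * σ x = 0)
    (hx1 : Valued.v x ≤ 1) (hz1 : Valued.v z ≤ 1)
    (hxr : Valued.v ϖ ^ m ≤ Valued.v ϖ ^ r * Valued.v x) (hzx : Valued.v ϖ ^ m * Valued.v z ≤ Valued.v ϖ ^ r' * Valued.v x)
    {δ : ℕ} (hz2 : Valued.v ϖ ^ m * Valued.v z ≤ Valued.v ϖ ^ (δ + 1) * (Valued.v x * Valued.v x))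
    (hr'm : r' ≤ m) (hs'm : s' ≤ m) (hs : s + δ ≤ 2 * r) (hs' : s' + δ ≤ 2 * r')
    (hc : Valued.v c ≤ Valued.v ϖ ^ m) (ht : t + σ t = 1) (hδ : Valued.v t * Valued.v ϖ ^ δ ≤ 1) (hδm : δ ≤ m) :
    ∃ u : ↥(unitaryGroupOfForm σ J), u ∈ unipotentU σ J ∧ nb⁻¹ * u * nb ∈ Jg ∧
      ∃ ε : K, Valued.v ε ≤ Valued.v ϖ ^ (m + 1) ∧
        (((nb⁻¹ * u * nb : ↥(unitaryGroupOfForm σ J)) : GL (Fin 3) K) : Matrix (Fin 3) (Fin 3) K) 0 0 = (1 + c) * (1 + ε) := by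
  have hϖ0 : ϖ ≠ 0 := CartanUnique.uniformizer_ne_zero hvϖ
  have hvϖ0 : Valued.v ϖ ≠ 0 := (Valuation.ne_zero_iff _).2 hϖ0
  have hvϖ1 : Valued.v ϖ ≤ 1 := by rw [hvϖ, ← WithZero.exp_zero, WithZero.exp_le_exp]; norm_num
  have hvϖlt : Valued.v ϖ < 1 := by rw [hvϖ, ← WithZero.exp_zero, WithZero.exp_lt_exp]; norm_num
  have hvϖmlt : Valued.v ϖ ^ m < 1 := pow_lt_one' hvϖlt (Nat.one_le_iff_ne_zero.1 hm)
  have hx0 : x ≠ 0 := fun h => by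
    rw [h, map_zero, mul_zero] at hxr
    exact absurd hxr (not_le.2 (pow_pos (zero_lt_iff.2 hvϖ0) m))
  have hvx0 : Valued.v x ≠ 0 := (Valuation.ne_zero_iff _).2 hx0
  have hσx : σ x ≠ 0 := (map_ne_zero σ).2 hx0
  -- powers of `|ϖ|`
  have hPr : Valued.v ϖ ^ r ≤ 1 := pow_le_one' hvϖ1 r
  have hPs : Valued.v ϖ ^ s ≤ 1 := pow_le_one' hvϖ1 s
  have hP2r_sδ : Valued.v ϖ ^ r * Valued.v ϖ ^ r ≤ Valued.v ϖ ^ s * Valued.v ϖ ^ δ := by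
    rw [← pow_add, ← pow_add]; exact v_pow_le_pow hvϖ1 (by omega)
  have hP2r'_s'δ : Valued.v ϖ ^ r' * Valued.v ϖ ^ r' ≤ Valued.v ϖ ^ s' * Valued.v ϖ ^ δ := by
    rw [← pow_add, ← pow_add]; exact v_pow_le_pow hvϖ1 (by omega)
  have hPm_r' : Valued.v ϖ ^ m ≤ Valued.v ϖ ^ r' := v_pow_le_pow hvϖ1 hr'm
  have hPm_s' : Valued.v ϖ ^ m ≤ Valued.v ϖ ^ s' := v_pow_le_pow hvϖ1 hs'm
  -- the defect absorptions `|ϖ|^δ·|t| ≤ 1` and `|ϖ|ᵐ·|t| ≤ 1` (`δ ≤ m`)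
  have hδt : Valued.v ϖ ^ δ * Valued.v t ≤ 1 := by rw [mul_comm]; exact hδ
  have hmt : Valued.v ϖ ^ m * Valued.v t ≤ 1 := (mul_le_mul' (v_pow_le_pow hvϖ1 hδm) le_rfl).trans hδt
  -- the element `u = u(y, b)`
  obtain ⟨y, hy⟩ : ∃ y : K, y = -c / σ x := ⟨_, rfl⟩
  obtain ⟨b, hb⟩ : ∃ b : K, b = -(y * σ y) * t := ⟨_, rfl⟩
  obtain ⟨u, huN, hu⟩ := K2E3LowerUnipotentBigCellIntegral.exists_upper_of_rel σ hJ hσ (a := y) (b := b) (familyXT_rel σ hσ ht hb)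
  have hyc : y * σ x = -c := familyX_y_mul σ hy hσx
  -- `|y||x| = |c|` and `|b| = |y|²|t|` (exact; no integrality of `t`)
  have hyx : Valued.v y * Valued.v x = Valued.v c := by rw [← hvσ x, ← map_mul, hyc, Valuation.map_neg]
  have hvb : Valued.v b ≤ Valued.v y * Valued.v y * Valued.v t := by rw [hb, map_mul, Valuation.map_neg, map_mul, hvσ]
  -- `|y| ≤ |ϖ|ʳ ≤ 1`: `|y||x| = |c| ≤ |ϖ|ᵐ ≤ |ϖ|ʳ|x|`
  have hvyr : Valued.v y ≤ Valued.v ϖ ^ r := by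
    refine le_of_mul_le_mul_v (C := Valued.v x) ?_ hvx0
    rw [hyx]; exact hc.trans hxr
  have hvy : Valued.v y ≤ 1 := hvyr.trans hPr
  have hvσy : Valued.v (σ y) ≤ 1 := by rw [hvσ]; exact hvy
  -- `|b| ≤ |y|²|t| ≤ |ϖ|^{2r}|t| ≤ |ϖ|ˢ·(|ϖ|^δ|t|) ≤ |ϖ|ˢ`, `|b| ≤ 1`
  have hvbs : Valued.v b ≤ Valued.v ϖ ^ s :=
    calc Valued.v b ≤ Valued.v y * Valued.v y * Valued.v t := hvb
      _ ≤ Valued.v ϖ ^ r * Valued.v ϖ ^ r * Valued.v t := mul_le_mul' (mul_le_mul' hvyr hvyr) le_rfl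
      _ ≤ Valued.v ϖ ^ s * Valued.v ϖ ^ δ * Valued.v t := mul_le_mul' hP2r_sδ le_rfl
      _ = Valued.v ϖ ^ s * (Valued.v ϖ ^ δ * Valued.v t) := mul_assoc _ _ _
      _ ≤ Valued.v ϖ ^ s * 1 := mul_le_mul' le_rfl hδt
      _ = Valued.v ϖ ^ s := mul_one _
  have hvb1 : Valued.v b ≤ 1 := hvbs.trans hPs
  -- `|y|·|z| ≤ |ϖ|^{r′}`: `|y||z||x| = |c||z| ≤ |ϖ|ᵐ|z| ≤ |ϖ|^{r′}|x|`
  have hvyz : Valued.v y * Valued.v z ≤ Valued.v ϖ ^ r' := by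
    refine le_of_mul_le_mul_v (C := Valued.v x) ?_ hvx0
    calc Valued.v y * Valued.v z * Valued.v x = Valued.v y * Valued.v x * Valued.v z := mul_right_comm _ _ _
      _ = Valued.v c * Valued.v z := by rw [hyx]
      _ ≤ Valued.v ϖ ^ m * Valued.v z := mul_le_mul' hc le_rfl
      _ ≤ Valued.v ϖ ^ r' * Valued.v x := hzx
  -- `|c|·|x| ≤ |ϖ|^{r′}`, `|c|·|z| ≤ |ϖ|^{s′}`, `|c| ≤ 1`
  have hvc1 : Valued.v c ≤ 1 := hc.trans (pow_le_one' hvϖ1 m)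
  have hcx : Valued.v c * Valued.v x ≤ Valued.v ϖ ^ r' := (mul_le_mul' (hc.trans hPm_r') hx1).trans_eq (mul_one _)
  have hcz : Valued.v c * Valued.v z ≤ Valued.v ϖ ^ s' := (mul_le_mul' (hc.trans hPm_s') hz1).trans_eq (mul_one _)
  -- `|b z| ≤ |ϖ|^{m+1}`: `|b||x|²|z| ≤ |c|²|t||z| ≤ |ϖ|ᵐ|t|·(|ϖ|ᵐ|z|) ≤ |ϖ|ᵐ|t|·|ϖ|^{δ+1}|x|² = |ϖ|^{m+1}|x|²·(|ϖ|^δ|t|)`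
  have hbz : Valued.v (b * z) ≤ Valued.v ϖ ^ (m + 1) := by
    refine le_of_mul_le_mul_v (C := Valued.v x * Valued.v x) ?_ (mul_ne_zero hvx0 hvx0)
    calc Valued.v (b * z) * (Valued.v x * Valued.v x) = Valued.v b * (Valued.v x * Valued.v x) * Valued.v z := by
          rw [map_mul]; simp only [mul_comm, mul_left_comm]
      _ ≤ Valued.v y * Valued.v y * Valued.v t * (Valued.v x * Valued.v x) * Valued.v z := mul_le_mul' (mul_le_mul' hvb le_rfl) le_rfl
      _ = Valued.v y * Valued.v x * (Valued.v y * Valued.v x) * (Valued.v t * Valued.v z) := by simp only [mul_comm, mul_left_comm]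
      _ = Valued.v c * Valued.v c * (Valued.v t * Valued.v z) := by rw [hyx]
      _ ≤ Valued.v ϖ ^ m * Valued.v ϖ ^ m * (Valued.v t * Valued.v z) := mul_le_mul' (mul_le_mul' hc hc) le_rfl
      _ = Valued.v ϖ ^ m * Valued.v t * (Valued.v ϖ ^ m * Valued.v z) := by ac_rfl
      _ ≤ Valued.v ϖ ^ m * Valued.v t * (Valued.v ϖ ^ (δ + 1) * (Valued.v x * Valued.v x)) := mul_le_mul' le_rfl hz2
      _ = Valued.v ϖ ^ (m + 1) * (Valued.v x * Valued.v x) * (Valued.v ϖ ^ δ * Valued.v t) := by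
          have hps : Valued.v ϖ ^ (δ + 1) = Valued.v ϖ ^ δ * Valued.v ϖ := pow_succ _ _
          have hpm : Valued.v ϖ ^ (m + 1) = Valued.v ϖ ^ m * Valued.v ϖ := pow_succ _ _
          rw [hps, hpm]; ac_rfl
      _ ≤ Valued.v ϖ ^ (m + 1) * (Valued.v x * Valued.v x) * 1 := mul_le_mul' le_rfl hδt
      _ = Valued.v ϖ ^ (m + 1) * (Valued.v x * Valued.v x) := mul_one _
  -- the seven entries: bounds on the monomials
  have e01 := conj_upper_apply_zero_one σ hJ hσ hnb hu
  have e02 := conj_upper_apply_zero_two σ hJ hσ hnb hu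
  have e12 := conj_upper_apply_one_two σ hJ hσ hnb hu
  have e00 := K2E3LowerUnipotentConjUpperEntries.conj_upper_apply_zero_zero_of_familyX σ hJ hσ hnb hu hyc
  have e10 := K2E3LowerUnipotentConjUpperEntries.conj_upper_apply_one_zero σ hJ hσ hnb hu
  have e20 := K2E3LowerUnipotentConjUpperEntries.conj_upper_apply_two_zero σ hJ hσ hnb hu hrel
  have e21 := K2E3LowerUnipotentConjUpperEntries.conj_upper_apply_two_one σ hJ hσ hnb hu
  -- `|bx| ≤ |ϖ|ʳ`: `|b||x| ≤ |y|²|t||x| = |y|·|c|·|t| ≤ |ϖ|ʳ·(|ϖ|ᵐ|t|) ≤ |ϖ|ʳ`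
  have hbx : Valued.v (b * x) ≤ Valued.v ϖ ^ r := by
    rw [map_mul]
    calc Valued.v b * Valued.v x ≤ Valued.v y * Valued.v y * Valued.v t * Valued.v x := mul_le_mul' hvb le_rfl
      _ = Valued.v y * (Valued.v y * Valued.v x) * Valued.v t := by simp only [mul_comm, mul_left_comm]
      _ = Valued.v y * Valued.v c * Valued.v t := by rw [hyx]
      _ ≤ Valued.v ϖ ^ r * Valued.v ϖ ^ m * Valued.v t := mul_le_mul' (mul_le_mul' hvyr hc) le_rfl
      _ = Valued.v ϖ ^ r * (Valued.v ϖ ^ m * Valued.v t) := mul_assoc _ _ _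
      _ ≤ Valued.v ϖ ^ r * 1 := mul_le_mul' le_rfl hmt
      _ = Valued.v ϖ ^ r := mul_one _
  have hxb : Valued.v (σ x * b) ≤ Valued.v ϖ ^ r := by rw [map_mul, hvσ, mul_comm, ← map_mul]; exact hbx
  -- lower monomials
  have hyxx : Valued.v (y * σ x * σ x) ≤ Valued.v ϖ ^ r' := by
    rw [map_mul, map_mul, hvσ, hyx]; exact hcx
  have hxbz : Valued.v (σ x * b * z) ≤ Valued.v ϖ ^ r' := by
    rw [mul_assoc, map_mul, hvσ]
    exact (mul_le_mul' hx1 (hbz.trans (v_pow_le_pow hvϖ1 (by omega)))).trans_eq (one_mul _)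
  have hyz : Valued.v (σ y * z) ≤ Valued.v ϖ ^ r' := by rw [map_mul, hvσ]; exact hvyz
  have hzy : Valued.v (σ z * y) ≤ Valued.v ϖ ^ r' := by rw [map_mul, hvσ, mul_comm]; exact hvyz
  have hzbx : Valued.v (σ z * b * x) ≤ Valued.v ϖ ^ r' := by
    -- `|z||b||x| ≤ |z|·|y|²|t|·|x| = (|y||z|)·|c|·|t| ≤ |ϖ|^{r′}·(|ϖ|ᵐ|t|) ≤ |ϖ|^{r′}`
    rw [map_mul, map_mul, hvσ]
    calc Valued.v z * Valued.v b * Valued.v x ≤ Valued.v z * (Valued.v y * Valued.v y * Valued.v t) * Valued.v x :=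
          mul_le_mul' (mul_le_mul' le_rfl hvb) le_rfl
      _ = Valued.v y * Valued.v z * (Valued.v y * Valued.v x) * Valued.v t := by simp only [mul_comm, mul_left_comm]
      _ = Valued.v y * Valued.v z * Valued.v c * Valued.v t := by rw [hyx]
      _ ≤ Valued.v ϖ ^ r' * Valued.v ϖ ^ m * Valued.v t := mul_le_mul' (mul_le_mul' hvyz hc) le_rfl
      _ = Valued.v ϖ ^ r' * (Valued.v ϖ ^ m * Valued.v t) := mul_assoc _ _ _
      _ ≤ Valued.v ϖ ^ r' * 1 := mul_le_mul' le_rfl hmt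
      _ = Valued.v ϖ ^ r' := mul_one _
  have hxxy : Valued.v (x * x * σ y) ≤ Valued.v ϖ ^ r' := by
    rw [show x * x * σ y = (σ y * x) * x by ring, map_mul, map_mul, hvσ, hyx]; exact hcx
  have hzbz : Valued.v (σ z * b * z) ≤ Valued.v ϖ ^ s' := by
    -- `|z|²|b| ≤ (|y||z|)²·|t| ≤ |ϖ|^{2r′}|t| ≤ |ϖ|^{s′}·(|ϖ|^δ|t|) ≤ |ϖ|^{s′}`
    rw [map_mul, map_mul, hvσ]
    calc Valued.v z * Valued.v b * Valued.v z ≤ Valued.v z * (Valued.v y * Valued.v y * Valued.v t) * Valued.v z :=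
          mul_le_mul' (mul_le_mul' le_rfl hvb) le_rfl
      _ = (Valued.v y * Valued.v z) * (Valued.v y * Valued.v z) * Valued.v t := by simp only [mul_comm, mul_left_comm]
      _ ≤ Valued.v ϖ ^ r' * Valued.v ϖ ^ r' * Valued.v t := mul_le_mul' (mul_le_mul' hvyz hvyz) le_rfl
      _ ≤ Valued.v ϖ ^ s' * Valued.v ϖ ^ δ * Valued.v t := mul_le_mul' hP2r'_s'δ le_rfl
      _ = Valued.v ϖ ^ s' * (Valued.v ϖ ^ δ * Valued.v t) := mul_assoc _ _ _
      _ ≤ Valued.v ϖ ^ s' * 1 := mul_le_mul' le_rfl hδt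
      _ = Valued.v ϖ ^ s' := mul_one _
  have hxyz : Valued.v (x * σ y * z) ≤ Valued.v ϖ ^ s' := by
    rw [show x * σ y * z = (σ y * x) * z by ring, map_mul, map_mul, hvσ, hyx]; exact hcz
  have hzyx : Valued.v (σ z * y * σ x) ≤ Valued.v ϖ ^ s' := by
    rw [show σ z * y * σ x = σ z * (y * σ x) by ring, hyc, map_mul, Valuation.map_neg, hvσ, mul_comm]; exact hcz
  -- `u`, `ū`, hence `j`, integral
  have huK : (u : GL (Fin 3) K) ∈ glInt 3 K := mem_glInt_of_coe_eq σ hJ hvσ hu fun i j => by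
    fin_cases i <;> fin_cases j <;> simp [hvb1, hvy, hvσy]
  have hnbK : (nb : GL (Fin 3) K) ∈ glInt 3 K := mem_glInt_of_coe_eq_lower σ hJ hvσ hnb hx1 hz1
  have hjK : nb⁻¹ * u * nb ∈ (glInt 3 K).subgroupOf (unitaryGroupOfForm σ J) :=
    Subgroup.mul_mem _ (Subgroup.mul_mem _ (Subgroup.inv_mem _ (Subgroup.mem_subgroupOf.2 hnbK)) (Subgroup.mem_subgroupOf.2 huK))
      (Subgroup.mem_subgroupOf.2 hnbK)
  refine ⟨u, huN, ?_, ?_⟩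
  · rw [hJg, K2E3IwahoriTwoDepthFactorisation.test_twoDepth_iff σ hvϖ1 r s r' s']
    refine ⟨(mem_glInt_subgroupOf_iff σ hJ hvσ _).1 hjK, ?_, ?_, ?_, ?_, ?_, ?_⟩
    · rw [e01]; exact Valued.v.map_add_le hvyr hbx
    · rw [e12]; refine Valued.v.map_sub_le hxb ?_; rw [hvσ]; exact hvyr
    · rw [e02]; exact hvbs
    · rw [e10]
      refine Valued.v.map_sub_le (Valued.v.map_add_le ?_ hxbz) hyz
      rw [Valuation.map_neg]; exact hyxx
    · rw [e21]; exact Valued.v.map_add_le (Valued.v.map_add_le hzy hzbx) hxxy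
    · rw [e20]; exact Valued.v.map_sub_le (Valued.v.map_add_le hzbz hxyz) hzyx
  · have hclt : Valued.v c < Valued.v (1 : K) := by rw [Valuation.map_one]; exact lt_of_le_of_lt hc hvϖmlt
    have h1c : Valued.v (1 + c) = 1 := by rw [Valuation.map_add_eq_of_lt_left _ hclt, Valuation.map_one]
    have h1c0 : (1 + c : K) ≠ 0 := fun h => by rw [h, map_zero] at h1c; exact zero_ne_one h1c
    refine ⟨b * z / (1 + c), ?_, ?_⟩
    · rw [map_div₀, h1c, div_one]; exact hbz
    · rw [e00]
      field_simp

include hJ hσ hvσ hvϖ hJg in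
/-- JUNCTION (`δ = 0`): the defect-free statement ★ `exists_familyX_witness_twoDepth` (letter `hvt : |t| ≤ 1`, `hz2` at `|ϖ|·|x|²`, `s ≤ 2r`, `s′ ≤ 2r′`) is the instance `δ := 0` of the
theorem above — so the tame∕unramified witnesses are not restated. [cite: Roche1998, §3–§4] -/
example {m : ℕ} (hm : 1 ≤ m) {nb : ↥(unitaryGroupOfForm σ J)} {x z c t : K}
    (hnb : ((nb : GL (Fin 3) K) : Matrix (Fin 3) (Fin 3) K) = !![1, 0, 0; -σ x, 1, 0; z, x, 1]) (hrel : z + σ z + x * σ x = 0)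
    (hx1 : Valued.v x ≤ 1) (hz1 : Valued.v z ≤ 1)
    (hxr : Valued.v ϖ ^ m ≤ Valued.v ϖ ^ r * Valued.v x) (hzx : Valued.v ϖ ^ m * Valued.v z ≤ Valued.v ϖ ^ r' * Valued.v x)
    (hz2 : Valued.v ϖ ^ m * Valued.v z ≤ Valued.v ϖ * (Valued.v x * Valued.v x))
    (hr'm : r' ≤ m) (hs'm : s' ≤ m) (hs : s ≤ 2 * r) (hs' : s' ≤ 2 * r')
    (hc : Valued.v c ≤ Valued.v ϖ ^ m) (ht : t + σ t = 1) (hvt : Valued.v t ≤ 1) :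
    ∃ u : ↥(unitaryGroupOfForm σ J), u ∈ unipotentU σ J ∧ nb⁻¹ * u * nb ∈ Jg ∧
      ∃ ε : K, Valued.v ε ≤ Valued.v ϖ ^ (m + 1) ∧
        (((nb⁻¹ * u * nb : ↥(unitaryGroupOfForm σ J)) : GL (Fin 3) K) : Matrix (Fin 3) (Fin 3) K) 0 0 = (1 + c) * (1 + ε) :=
  exists_familyX_witness_twoDepth_ofDefect σ hJ hσ hvσ hvϖ r s r' s' Jg hJg hm hnb hrel hx1 hz1 hxr hzx (δ := 0)
    (by rw [zero_add, pow_one]; exact hz2) hr'm hs'm (by omega) (by omega) hc ht (by rw [pow_zero, mul_one]; exact hvt) (Nat.zero_le _)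

end Valuation

end Summit.HodgeConjecture.HodgeConjecture.R90.S1.WildFamilyXWitness

end
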